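import Literature.NumberTheory.LFunctions.WeilOddThetaVector
import Literature.NumberTheory.LFunctions.WeilMarkovQuadratic
import Literature.NumberTheory.LFunctions.DeBruijnPhiDecreasing

/-!
# Route GroundBarta, crux `GroundBartaFloor`: the even theta vector and its window image (definitions)

Definition file of line `phi_window_supersolution` of crux item stmt-RiemannHypothesis-18389
(`GroundBartaFloor`, route `RiemannHypothesis/GroundBarta`). Normalisation of
`Literature/NumberTheory/LFunctions/WeilExplicit.lean` (additive variable `t = log x`,
`W = weilFunctional = polar − prime + arch`) and of `WeilOddThetaVector.lean` (`Φ = weilThetaPhi`,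
Riemann's kernel, `Φ̂ = ξ`), `w = weilArchDensity` (`e^{r/2}/(2 sinh r)`).

The EVEN THETA VECTOR is the window truncation `K_a = 𝟙_{[−a,a]}·Φ` of the Weil-harmonic kernel `Φ`.
For a smooth test `g` supported in the window `[−a, a]`, the polarised Weil functional against the BV
probe `K_a` is `W(g ⋆ K̃_a) = ∫ g(t) T_a(t) dt` with the WINDOW IMAGE (on the open window)

  `T_a(t) = −2ϖ_a cosh(t/2) + Σ_n Λ(n) n^{-1/2} (R_a(t − log n) + R_a(t + log n)) + ∫ R_a(s) w(|t − s|) ds`,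

where `R_a = Φ − K_a = 𝟙_{|s|>a}·Φ ≥ 0` is the EVEN TAIL and `ϖ_a = ∫_{s>a} Φ(s)·2 cosh(s/2) ds ≥ 0`
its polar weight: `Φ` is a null vector of Weil's form (harmonicity of the translates of `Φ`,
`(prime − arch_Bombieri)(τ_t Φ) = cosh(t/2)`), so only the off-diagonal image of the tail survives.
The polar leakage `−2ϖ_a cosh(t/2)` is the only negative term; `e(a) = 2ϖ_a cosh(a/2)/Φ(a)` is the
explicit BARTA RATE of the supersolution inequality `T_a ≥ −e(a) K_a` on `(−a, a)`.
This file only DEFINES the objects and records their unfoldings and elementary sign / size facts;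
all analytic properties are proved in the sibling `GroundBartaGroundBartaFloor*.lean` files.
-/

-- `Summit.RiemannHypothesis.RiemannHypothesis.…` repeats the summit name by design (D-0017 layout).
set_option linter.dupNamespace false

noncomputable section

open Set MeasureTheory
open scoped Real ArithmeticFunction.vonMangoldt ENNReal

namespace Summit.RiemannHypothesis.RiemannHypothesis.Theorems.GroundBartaFloor

open Literature.NumberTheory.LFunctions

/-! ## Definitions -/

/-- The EVEN THETA VECTOR `K_a := 𝟙_{[−a,a]} · Φ` (window truncation of the null vector `Φ`). -/
def groundThetaVector (a : ℝ) : ℝ → ℝ :=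
  (Icc (-a) a).indicator weilThetaPhi

/-- The EVEN TAIL `R_a := Φ − K_a = 𝟙_{|s|>a} · Φ` (non-negative). -/
def groundThetaTail (a : ℝ) (s : ℝ) : ℝ :=
  weilThetaPhi s - groundThetaVector a s

/-- The POLAR WEIGHT `ϖ_a := ∫_{s>a} Φ(s)·2 cosh(s/2) ds` (`= ∫_{|s|>a} Φ(s) cosh(s/2) ds`). -/
def groundThetaPolarWeight (a : ℝ) : ℝ :=
  ∫ s in Ioi a, weilThetaPhi s * (2 * Real.cosh (s / 2))

/-- The PRIME LAYER `P_a(t) := Σ_n Λ(n) n^{-1/2} (R_a(t − log n) + R_a(t + log n))` (non-negative). -/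
def groundThetaPrimeLayer (a : ℝ) (t : ℝ) : ℝ :=
  ∑' n : ℕ, (Λ n : ℝ) / Real.sqrt n *
    (groundThetaTail a (t - Real.log n) + groundThetaTail a (t + Real.log n))

/-- The ARCHIMEDEAN LAYER `A_a(t) := ∫ R_a(s) w(|t − s|) ds`, `w = weilArchDensity` (non-negative;
logarithmically singular as `t → ±a`; a real Bochner integral). -/
def groundThetaArchLayer (a : ℝ) (t : ℝ) : ℝ :=
  ∫ s, groundThetaTail a s * weilArchDensity |t - s|

/-- The WINDOW IMAGE `T_a(t) := −2ϖ_a cosh(t/2) + P_a(t) + A_a(t)` of the even theta vector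
(`W(g ⋆ K̃_a) = ∫ g T_a` for window tests `g`). -/
def groundThetaImage (a : ℝ) (t : ℝ) : ℝ :=
  -(2 * groundThetaPolarWeight a * Real.cosh (t / 2)) + groundThetaPrimeLayer a t +
    groundThetaArchLayer a t

/-- The explicit BARTA RATE `e(a) := 2ϖ_a cosh(a/2) / Φ(a)` (`≈ e^{−a}/(2π)`, `→ 0`). -/
def groundBartaRate (a : ℝ) : ℝ :=
  2 * groundThetaPolarWeight a * Real.cosh (a / 2) / weilThetaPhi a

/-! ## Unfolding lemmas -/

/-- Unfolding: `K_a = 𝟙_{[−a,a]} Φ`. -/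
theorem groundThetaVector_def (a : ℝ) : groundThetaVector a = (Icc (-a) a).indicator weilThetaPhi :=
  rfl

/-- Unfolding: `R_a = Φ − K_a`. -/
theorem groundThetaTail_def (a s : ℝ) :
    groundThetaTail a s = weilThetaPhi s - groundThetaVector a s := rfl

/-- Unfolding: `ϖ_a = ∫_{s>a} Φ(s)·2cosh(s/2) ds`. -/
theorem groundThetaPolarWeight_def (a : ℝ) :
    groundThetaPolarWeight a = ∫ s in Ioi a, weilThetaPhi s * (2 * Real.cosh (s / 2)) := rfl

/-- Unfolding: `P_a(t) = Σ_n Λ(n) n^{-1/2} (R_a(t − log n) + R_a(t + log n))`. -/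
theorem groundThetaPrimeLayer_def (a t : ℝ) :
    groundThetaPrimeLayer a t = ∑' n : ℕ, (Λ n : ℝ) / Real.sqrt n *
      (groundThetaTail a (t - Real.log n) + groundThetaTail a (t + Real.log n)) := rfl

/-- Unfolding: `A_a(t) = ∫ R_a(s) w(|t − s|) ds`. -/
theorem groundThetaArchLayer_def (a t : ℝ) :
    groundThetaArchLayer a t = ∫ s, groundThetaTail a s * weilArchDensity |t - s| := rfl

/-- Unfolding: `T_a = −2ϖ_a cosh(·/2) + P_a + A_a`. -/
theorem groundThetaImage_def (a t : ℝ) :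
    groundThetaImage a t =
      -(2 * groundThetaPolarWeight a * Real.cosh (t / 2)) + groundThetaPrimeLayer a t +
        groundThetaArchLayer a t := rfl

/-- Unfolding: `e(a) = 2ϖ_a cosh(a/2)/Φ(a)`. -/
theorem groundBartaRate_def (a : ℝ) :
    groundBartaRate a = 2 * groundThetaPolarWeight a * Real.cosh (a / 2) / weilThetaPhi a := rfl

/-! ## Elementary facts about the even theta vector and its tail -/

/-- On the closed window, `K_a = Φ`. -/
theorem groundThetaVector_of_mem {a t : ℝ} (ht : t ∈ Icc (-a) a) :
    groundThetaVector a t = weilThetaPhi t :=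
  indicator_of_mem ht _

/-- Off the closed window, `K_a = 0`. -/
theorem groundThetaVector_of_not_mem {a t : ℝ} (ht : t ∉ Icc (-a) a) : groundThetaVector a t = 0 :=
  indicator_of_notMem ht _

/-- `K_a ≥ 0`. -/
theorem groundThetaVector_nonneg (a t : ℝ) : 0 ≤ groundThetaVector a t := by
  by_cases ht : t ∈ Icc (-a) a
  · rw [groundThetaVector_of_mem ht]; exact (weilThetaPhi_pos t).le
  · rw [groundThetaVector_of_not_mem ht]

/-- `K_a > 0` on the closed window. -/
theorem groundThetaVector_pos {a t : ℝ} (ht : t ∈ Icc (-a) a) : 0 < groundThetaVector a t := by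
  rw [groundThetaVector_of_mem ht]; exact weilThetaPhi_pos t

/-- `K_a` is even. -/
theorem groundThetaVector_neg (a t : ℝ) : groundThetaVector a (-t) = groundThetaVector a t := by
  by_cases ht : t ∈ Icc (-a) a
  · rw [groundThetaVector_of_mem ht, groundThetaVector_of_mem (neg_mem_Icc_neg_iff.2 ht),
      weilThetaPhi_neg]
  · rw [groundThetaVector_of_not_mem ht,
      groundThetaVector_of_not_mem fun h => ht (neg_mem_Icc_neg_iff.1 h)]

/-- `K_a ≤ Φ`. -/
theorem groundThetaVector_le (a t : ℝ) : groundThetaVector a t ≤ weilThetaPhi t := by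
  by_cases ht : t ∈ Icc (-a) a
  · rw [groundThetaVector_of_mem ht]
  · rw [groundThetaVector_of_not_mem ht]; exact (weilThetaPhi_pos t).le

/-- `|K_a| ≤ Φ(0)` (`Φ` is maximal at `0`). -/
theorem abs_groundThetaVector_le (a t : ℝ) : |groundThetaVector a t| ≤ weilThetaPhi 0 := by
  rw [abs_of_nonneg (groundThetaVector_nonneg a t)]
  refine (groundThetaVector_le a t).trans ?_
  rcases eq_or_ne t 0 with rfl | h0
  · exact le_rfl
  · exact (weilThetaPhi_lt_weilThetaPhi_zero h0).le

/-- `K_a` is measurable. -/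
theorem measurable_groundThetaVector (a : ℝ) : Measurable (groundThetaVector a) :=
  continuous_weilThetaPhi.measurable.indicator measurableSet_Icc

/-- `K_a ∈ L^p` for every `p` (bounded, supported in the window). -/
theorem memLp_groundThetaVector (a : ℝ) (p : ℝ≥0∞) : MemLp (groundThetaVector a) p volume := by
  have htop : MemLp (groundThetaVector a) ∞ volume :=
    memLp_top_of_bound (measurable_groundThetaVector a).aestronglyMeasurable (weilThetaPhi 0)
      (Filter.Eventually.of_forall fun t => by
        rw [Real.norm_eq_abs]; exact abs_groundThetaVector_le a t)
  exact htop.mono_exponent_of_measure_support_ne_top (s := Icc (-a) a)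
    (fun _ ht => groundThetaVector_of_not_mem ht) (by simp [Real.volume_Icc]) le_top

/-- On the closed window, `R_a = 0`. -/
theorem groundThetaTail_of_mem {a s : ℝ} (hs : s ∈ Icc (-a) a) : groundThetaTail a s = 0 := by
  rw [groundThetaTail_def, groundThetaVector_of_mem hs, sub_self]

/-- Off the closed window, `R_a = Φ`. -/
theorem groundThetaTail_of_not_mem {a s : ℝ} (hs : s ∉ Icc (-a) a) :
    groundThetaTail a s = weilThetaPhi s := by
  rw [groundThetaTail_def, groundThetaVector_of_not_mem hs, sub_zero]

/-- `R_a ≥ 0`. -/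
theorem groundThetaTail_nonneg (a s : ℝ) : 0 ≤ groundThetaTail a s := by
  by_cases hs : s ∈ Icc (-a) a
  · rw [groundThetaTail_of_mem hs]
  · rw [groundThetaTail_of_not_mem hs]; exact (weilThetaPhi_pos s).le

/-- `R_a ≤ Φ`. -/
theorem groundThetaTail_le (a s : ℝ) : groundThetaTail a s ≤ weilThetaPhi s := by
  rw [groundThetaTail_def]
  linarith [groundThetaVector_nonneg a s]

/-- `|R_a| ≤ Φ`. -/
theorem abs_groundThetaTail_le (a s : ℝ) : |groundThetaTail a s| ≤ weilThetaPhi s := by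
  rw [abs_of_nonneg (groundThetaTail_nonneg a s)]
  exact groundThetaTail_le a s

/-- `R_a` is even. -/
theorem groundThetaTail_neg (a s : ℝ) : groundThetaTail a (-s) = groundThetaTail a s := by
  rw [groundThetaTail_def, groundThetaTail_def, weilThetaPhi_neg, groundThetaVector_neg]

/-- `R_a` is measurable. -/
theorem measurable_groundThetaTail (a : ℝ) : Measurable (groundThetaTail a) :=
  continuous_weilThetaPhi.measurable.sub (measurable_groundThetaVector a)

/-! ## Signs of the layers and of the Barta rate -/

/-- `w(|r|) ≥ 0`. -/
theorem weilArchDensity_abs_nonneg (r : ℝ) : 0 ≤ weilArchDensity |r| := by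
  unfold weilArchDensity
  exact div_nonneg (Real.exp_pos _).le
    (mul_nonneg zero_le_two (Real.sinh_nonneg_iff.2 (abs_nonneg r)))

/-- `ϖ_a ≥ 0`. -/
theorem groundThetaPolarWeight_nonneg (a : ℝ) : 0 ≤ groundThetaPolarWeight a :=
  setIntegral_nonneg measurableSet_Ioi fun s _ =>
    mul_nonneg (weilThetaPhi_pos s).le (mul_nonneg zero_le_two (Real.cosh_pos _).le)

/-- `P_a ≥ 0` (termwise). -/
theorem groundThetaPrimeLayer_nonneg (a t : ℝ) : 0 ≤ groundThetaPrimeLayer a t :=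
  tsum_nonneg fun _ => mul_nonneg
    (div_nonneg ArithmeticFunction.vonMangoldt_nonneg (Real.sqrt_nonneg _))
    (add_nonneg (groundThetaTail_nonneg _ _) (groundThetaTail_nonneg _ _))

/-- `A_a ≥ 0` (non-negative integrand). -/
theorem groundThetaArchLayer_nonneg (a t : ℝ) : 0 ≤ groundThetaArchLayer a t :=
  integral_nonneg fun s => mul_nonneg (groundThetaTail_nonneg a s) (weilArchDensity_abs_nonneg _)

/-- `e(a) ≥ 0`. -/
theorem groundBartaRate_nonneg (a : ℝ) : 0 ≤ groundBartaRate a :=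
  div_nonneg (mul_nonneg (mul_nonneg zero_le_two (groundThetaPolarWeight_nonneg a))
    (Real.cosh_pos _).le) (weilThetaPhi_pos a).le

end Summit.RiemannHypothesis.RiemannHypothesis.Theorems.GroundBartaFloor

end
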